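import Summits.AtomisticToContinuum.HydrodynamicLimit.Theorems.RelayRaceLocalityConeLocalisationStubLogSlope
import HarnessLib

/-!
# RelayRaceLocality · ConeLocalisation — line `einstein-elevator`, stub `stub_logCurvature` (part A)

Support file for the crux item `stmt-AtomisticToContinuum-12504` (`ConeLocalisation`, route RelayRaceLocality of
`AtomisticToContinuum/HydrodynamicLimit`), first of the files proving the registered stub
`stub_logCurvature : DynamicLogSlopeBound → DynamicLogCurvatureBound` of the line `einstein-elevator`
(Props in `Theorems/RelayRaceLocalityConeLocalisationElevatorDefs.lean`): the floor-free a-priori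
estimate `|∂ᵢ∂ⱼ log ρ| ≤ C Mᵃ / t` for one classical hard-sphere Euler solution whose level-`M` guards
survive on `[0, t] × 𝕋³`, by the Lagrangian both-ends argument one derivative up
(`D_t ∂ᵢuⱼ = -∂ᵢGⱼ - (∂u ∂u)ᵢⱼ`, `|D_t ∂G| ≤ A ‖∂G‖ + B`, `‖∂u‖ ≤ M` at both ends of every path).

This part (namespace `…Elevator.LogCurvature`): (1) the both-ends ODE lemma with a bounded
remainder `norm_le_of_both_ends_rem`; (2) the smooth equation of state on a packing band with THREE
derivatives bounded (`eos_band3`, from `LogSlope.eos_band`); (3) a small bounded-derivative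
bookkeeping calculus (`bd_*`: value and derivative bounds are propagated through `+, -, *, ∘`
together with `HasDerivWithinAt`), used in parts B, C to bound the material derivatives of long
explicit expressions without restating them; (4) scalar guard bounds of order `≤ 3`.
-/

noncomputable section

namespace Summit.AtomisticToContinuum.HydrodynamicLimit.Theorems.ConeLocalisation.Elevator.LogCurvature

open scoped Topology ContDiff NNReal
open Filter Set MeasureTheory
open Literature.MathematicalPhysics.KineticTheory Literature.Analysis.FluidPDE
  Literature.Analysis.FunctionSpaces
open Literature.Analysis.FluidPDE.CompressibleEuler (abs_mul_le_of_le)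
open Literature.MathematicalPhysics.KineticTheory.HsEulerCalc

/-! ### Step 1: the both-ends ODE lemma with a bounded remainder -/

/-- **Both-ends ODE lemma with remainder.** If `φ' = -(g + r)` with `‖r‖ ≤ R`, and
`‖g'‖ ≤ A ‖g‖ + B` on `[s₁, s₂]` with `A (s₂ - s₁) ≤ 1/4`, then
`‖g‖ ≤ (3/2) (‖φ s₂ - φ s₁‖ + R (s₂ - s₁)) / (s₂ - s₁) + 2 B (s₂ - s₁)` on `[s₁, s₂]`
(mean value inequality twice; adapted from `LogSlope.norm_le_of_both_ends`). [folklore] -/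
theorem norm_le_of_both_ends_rem {E : Type*} [NormedAddCommGroup E] [NormedSpace ℝ E]
    {φ g r : ℝ → E} {s₁ s₂ A B D R : ℝ} (hlt : s₁ < s₂)
    (hφ : ∀ s ∈ Icc s₁ s₂, HasDerivWithinAt φ (-(g s + r s)) (Icc s₁ s₂) s)
    (hr : ∀ s ∈ Icc s₁ s₂, ‖r s‖ ≤ R)
    (hg : ∀ s ∈ Icc s₁ s₂, ∃ v, HasDerivWithinAt g v (Icc s₁ s₂) s ∧ ‖v‖ ≤ A * ‖g s‖ + B)
    (hA : 0 ≤ A) (hB : 0 ≤ B) (hAℓ : A * (s₂ - s₁) ≤ 1 / 4) (hD : ‖φ s₂ - φ s₁‖ ≤ D)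
    {s : ℝ} (hs : s ∈ Icc s₁ s₂) :
    ‖g s‖ ≤ 3 / 2 * (D + R * (s₂ - s₁)) / (s₂ - s₁) + 2 * B * (s₂ - s₁) := by
  choose! g' hg' hg'n using hg
  set ℓ := s₂ - s₁ with hℓ
  have hℓ0 : 0 < ℓ := sub_pos.2 hlt
  have hcont : ContinuousOn (fun τ => ‖g τ‖) (Icc s₁ s₂) :=
    ContinuousOn.norm fun τ hτ => (hg' τ hτ).continuousWithinAt
  obtain ⟨s₀, hs₀, hmax⟩ := (isCompact_Icc (a := s₁) (b := s₂)).exists_isMaxOn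
    (nonempty_Icc.2 hlt.le) hcont
  set m := ‖g s₀‖ with hm
  have hgm : ∀ τ ∈ Icc s₁ s₂, ‖g τ‖ ≤ m := fun τ hτ => hmax hτ
  have hm0 : 0 ≤ m := norm_nonneg _
  have hg'b : ∀ τ ∈ Icc s₁ s₂, ‖g' τ‖ ≤ A * m + B := fun τ hτ =>
    (hg'n τ hτ).trans (by nlinarith [hgm τ hτ])
  -- mean value inequality for `g`
  have hmv : ∀ τ ∈ Icc s₁ s₂, ‖g τ - g s‖ ≤ (A * m + B) * ℓ := by
    intro τ hτ
    have h := (convex_Icc s₁ s₂).norm_image_sub_le_of_norm_hasDerivWithin_le hg' hg'b hs hτ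
    refine h.trans (mul_le_mul_of_nonneg_left ?_ (by positivity))
    rw [Real.norm_eq_abs, abs_le]
    constructor <;> linarith [hτ.1, hτ.2, hs.1, hs.2]
  have h1 : m ≤ ‖g s‖ + (A * m + B) * ℓ := by
    have h := hmv s₀ hs₀
    have h' : ‖g s₀‖ ≤ ‖g s‖ + ‖g s₀ - g s‖ := norm_le_insert' _ _
    linarith
  -- mean value inequality for `ψ = φ + (· - s) • g s`
  have hψ : ∀ τ ∈ Icc s₁ s₂,
      HasDerivWithinAt (fun τ => φ τ + (τ - s) • g s) (-(g τ + r τ) + g s) (Icc s₁ s₂) τ := by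
    intro τ hτ
    have h := ((hasDerivWithinAt_id τ (Icc s₁ s₂)).sub_const s).smul_const (g s)
    rw [one_smul] at h
    exact (hφ τ hτ).add h
  have hR : 0 ≤ R := (norm_nonneg _).trans (hr s hs)
  have hψ' : ∀ τ ∈ Icc s₁ s₂, ‖-(g τ + r τ) + g s‖ ≤ (A * m + B) * ℓ + R := by
    intro τ hτ
    have e : -(g τ + r τ) + g s = -(g τ - g s) + -r τ := by abel
    rw [e]
    refine (norm_add_le _ _).trans (add_le_add ?_ ?_)
    · rw [norm_neg]; exact hmv τ hτ
    · rw [norm_neg]; exact hr τ hτ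
  have h2 := (convex_Icc s₁ s₂).norm_image_sub_le_of_norm_hasDerivWithin_le hψ hψ'
    (left_mem_Icc.2 hlt.le) (right_mem_Icc.2 hlt.le)
  have hkey : ℓ * ‖g s‖ ≤ (D + R * ℓ) + (A * m + B) * ℓ * ℓ := by
    have e : (φ s₂ + (s₂ - s) • g s) - (φ s₁ + (s₁ - s) • g s) = (φ s₂ - φ s₁) + ℓ • g s := by
      rw [hℓ, sub_smul, sub_smul, sub_smul]
      abel
    have hn : ‖s₂ - s₁‖ = ℓ := by rw [Real.norm_eq_abs, abs_of_pos hℓ0]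
    rw [e, hn] at h2
    have h3 : ‖ℓ • g s‖ ≤ ‖(φ s₂ - φ s₁) + ℓ • g s‖ + ‖φ s₂ - φ s₁‖ := by
      have := norm_sub_le (φ s₂ - φ s₁ + ℓ • g s) (φ s₂ - φ s₁)
      rwa [add_sub_cancel_left] at this
    rw [norm_smul, Real.norm_eq_abs, abs_of_pos hℓ0] at h3
    nlinarith
  -- the algebra
  have hAm : A * ℓ * m ≤ 1 / 4 * m := mul_le_mul_of_nonneg_right hAℓ hm0
  have h1' : 3 / 4 * m ≤ ‖g s‖ + B * ℓ := by nlinarith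
  have h1'' : 3 / 4 * m * ℓ ≤ (‖g s‖ + B * ℓ) * ℓ := mul_le_mul_of_nonneg_right h1' hℓ0.le
  have hAm' : A * ℓ * m * ℓ ≤ 1 / 4 * m * ℓ := mul_le_mul_of_nonneg_right hAm hℓ0.le
  have hfin : ‖g s‖ * ℓ ≤ 3 / 2 * (D + R * ℓ) + 2 * B * ℓ * ℓ := by nlinarith
  calc ‖g s‖ = ‖g s‖ * ℓ / ℓ := by field_simp
    _ ≤ (3 / 2 * (D + R * ℓ) + 2 * B * ℓ * ℓ) / ℓ := by gcongr
    _ = 3 / 2 * (D + R * ℓ) / ℓ + 2 * B * ℓ := by field_simp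

/-! ### Step 2: the smooth equation of state with three bounded derivatives -/

/-- **EOS band, three derivatives.** `LogSlope.eos_band` with, in addition, the third derivative of
the smooth compressibility factor bounded by the same constant `K` on `[0, η₁]` (continuity on a
compact sub-band of the smoothness interval). [folklore] -/
theorem eos_band3 : ∃ η₀ η₁ K : ℝ, ∃ Zf : ℝ → ℝ, 0 < η₁ ∧ η₁ ≤ 1 ∧ 2 * η₁ ≤ η₀ ∧ 1 ≤ K ∧
    ContDiffOn ℝ ∞ Zf (Ioo (-η₀) η₀) ∧ EqOn hsCompressibility Zf (Ioo 0 η₀) ∧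
    ∀ η ∈ Icc 0 η₁, |Zf η| ≤ K ∧ |deriv Zf η| ≤ K ∧ |deriv (deriv Zf) η| ≤ K ∧
      |deriv (deriv (deriv Zf)) η| ≤ K ∧ 1 / 2 ≤ Zf η ∧ 1 / 2 ≤ Zf η + η * deriv Zf η := by
  obtain ⟨η₀, η₁, K, Zf, hη₁, hη₁1, hη₁₀, hK, hZ, hEq, hband⟩ := LogSlope.eos_band
  have hO : IsOpen (Ioo (-η₀) η₀) := isOpen_Ioo
  have hZ3 : ContDiffOn ℝ ∞ (deriv (deriv (deriv Zf))) (Ioo (-η₀) η₀) :=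
    ((hZ.deriv_of_isOpen hO le_rfl).deriv_of_isOpen hO le_rfl).deriv_of_isOpen hO le_rfl
  have hsub : Icc 0 η₁ ⊆ Ioo (-η₀) η₀ := fun η hη => ⟨by linarith [hη.1], by linarith [hη.2]⟩
  obtain ⟨C3, hC3⟩ := (isCompact_Icc (a := (0 : ℝ)) (b := η₁)).exists_bound_of_continuousOn
    (hZ3.continuousOn.mono hsub)
  refine ⟨η₀, η₁, max K C3, Zf, hη₁, hη₁1, hη₁₀, hK.trans (le_max_left _ _), hZ, hEq,
    fun η hη => ?_⟩
  obtain ⟨b0, b1, b2, l1, l2⟩ := hband η hη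
  have b3 := hC3 η hη
  rw [Real.norm_eq_abs] at b3
  exact ⟨b0.trans (le_max_left _ _), b1.trans (le_max_left _ _), b2.trans (le_max_left _ _),
    b3.trans (le_max_right _ _), l1, l2⟩

/-! ### Step 3: bounded-derivative bookkeeping -/

/-- Bookkeeping atom: a derivative with a value bound and a derivative bound. [folklore] -/
theorem bd_atom {f : ℝ → ℝ} {f' : ℝ} {S : Set ℝ} {τ a b : ℝ} (h : HasDerivWithinAt f f' S τ)
    (ha : |f τ| ≤ a) (hb : |f'| ≤ b) :
    ∃ f', HasDerivWithinAt f f' S τ ∧ |f τ| ≤ a ∧ |f'| ≤ b :=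
  ⟨f', h, ha, hb⟩

/-- Bookkeeping atom along a coordinate line of `𝕋³`: a `C¹` function with `|A x| ≤ a`,
`|∂ᵢA x| ≤ b`. [folklore] -/
theorem bd_coord {A : T3 → ℝ} (hA : Torus.IsContDiff 1 A) (x : T3) (i : Fin 3) {a b : ℝ}
    (ha : |A x| ≤ a) (hb : |Torus.partialDeriv i A x| ≤ b) :
    ∃ f', HasDerivWithinAt
        (fun r : ℝ => A (x + Torus.proj (r • EuclideanSpace.single i (1 : ℝ)))) f' univ 0 ∧
      |A (x + Torus.proj ((0 : ℝ) • EuclideanSpace.single i (1 : ℝ)))| ≤ a ∧ |f'| ≤ b :=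
  ⟨_, (hasDerivAt_coordLine hA x i).hasDerivWithinAt, by simpa using ha, hb⟩

/-- Bookkeeping atom along a coordinate line of `𝕋³` for a composite `ζ ∘ A` (`ζ` smooth on an open
set containing `A x`): `|ζ (A x)| ≤ a`, `|ζ'(A x) ∂ᵢA x| ≤ b`. [folklore] -/
theorem bd_coord_comp {A : T3 → ℝ} (hA : Torus.IsContDiff 1 A) {ζ : ℝ → ℝ} {J : Set ℝ}
    (hJ : IsOpen J) (hζ : ContDiffOn ℝ ∞ ζ J) (x : T3) (hx : A x ∈ J) (i : Fin 3) {a b : ℝ}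
    (ha : |ζ (A x)| ≤ a) (hb : |deriv ζ (A x) * Torus.partialDeriv i A x| ≤ b) :
    ∃ f', HasDerivWithinAt
        (fun r : ℝ => ζ (A (x + Torus.proj (r • EuclideanSpace.single i (1 : ℝ))))) f' univ 0 ∧
      |ζ (A (x + Torus.proj ((0 : ℝ) • EuclideanSpace.single i (1 : ℝ))))| ≤ a ∧ |f'| ≤ b :=
  ⟨_, (hasDerivAt_coordLine_comp hA hJ hζ x hx i).hasDerivWithinAt, by simpa using ha, hb⟩

/-- Bookkeeping: sum. [folklore] -/
theorem bd_add {f g : ℝ → ℝ} {S : Set ℝ} {τ a b c d : ℝ}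
    (hf : ∃ f', HasDerivWithinAt f f' S τ ∧ |f τ| ≤ a ∧ |f'| ≤ b)
    (hg : ∃ g', HasDerivWithinAt g g' S τ ∧ |g τ| ≤ c ∧ |g'| ≤ d) :
    ∃ h', HasDerivWithinAt (fun s => f s + g s) h' S τ ∧ |f τ + g τ| ≤ a + c ∧ |h'| ≤ b + d := by
  obtain ⟨f', hf, ha, hb⟩ := hf
  obtain ⟨g', hg, hc, hd⟩ := hg
  exact ⟨f' + g', hf.add hg, (abs_add_le _ _).trans (add_le_add ha hc),
    (abs_add_le _ _).trans (add_le_add hb hd)⟩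

/-- Bookkeeping: difference. [folklore] -/
theorem bd_sub {f g : ℝ → ℝ} {S : Set ℝ} {τ a b c d : ℝ}
    (hf : ∃ f', HasDerivWithinAt f f' S τ ∧ |f τ| ≤ a ∧ |f'| ≤ b)
    (hg : ∃ g', HasDerivWithinAt g g' S τ ∧ |g τ| ≤ c ∧ |g'| ≤ d) :
    ∃ h', HasDerivWithinAt (fun s => f s - g s) h' S τ ∧ |f τ - g τ| ≤ a + c ∧ |h'| ≤ b + d := by
  obtain ⟨f', hf, ha, hb⟩ := hf
  obtain ⟨g', hg, hc, hd⟩ := hg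
  exact ⟨f' - g', hf.sub hg, (abs_sub _ _).trans (add_le_add ha hc),
    (abs_sub _ _).trans (add_le_add hb hd)⟩

/-- Bookkeeping: negation. [folklore] -/
theorem bd_neg {f : ℝ → ℝ} {S : Set ℝ} {τ a b : ℝ}
    (hf : ∃ f', HasDerivWithinAt f f' S τ ∧ |f τ| ≤ a ∧ |f'| ≤ b) :
    ∃ h', HasDerivWithinAt (fun s => -f s) h' S τ ∧ |(-f τ)| ≤ a ∧ |h'| ≤ b := by
  obtain ⟨f', hf, ha, hb⟩ := hf
  exact ⟨-f', hf.neg, by rwa [abs_neg], by rwa [abs_neg]⟩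

/-- Bookkeeping: product (Leibniz rule). [folklore] -/
theorem bd_mul {f g : ℝ → ℝ} {S : Set ℝ} {τ a b c d : ℝ}
    (hf : ∃ f', HasDerivWithinAt f f' S τ ∧ |f τ| ≤ a ∧ |f'| ≤ b)
    (hg : ∃ g', HasDerivWithinAt g g' S τ ∧ |g τ| ≤ c ∧ |g'| ≤ d) :
    ∃ h', HasDerivWithinAt (fun s => f s * g s) h' S τ ∧ |f τ * g τ| ≤ a * c ∧
      |h'| ≤ b * c + a * d := by
  obtain ⟨f', hf, ha, hb⟩ := hf
  obtain ⟨g', hg, hc, hd⟩ := hg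
  exact ⟨f' * g τ + f τ * g', hf.mul hg, abs_mul_le_of_le ha hc,
    (abs_add_le _ _).trans (add_le_add (abs_mul_le_of_le hb hc) (abs_mul_le_of_le ha hd))⟩

/-- Bookkeeping: left multiplication by a constant `c` with `|c| ≤ c₀`. [folklore] -/
theorem bd_const_mul {f : ℝ → ℝ} {S : Set ℝ} {τ a b c₀ : ℝ} (c : ℝ) (hc : |c| ≤ c₀)
    (hf : ∃ f', HasDerivWithinAt f f' S τ ∧ |f τ| ≤ a ∧ |f'| ≤ b) :
    ∃ h', HasDerivWithinAt (fun s => c * f s) h' S τ ∧ |c * f τ| ≤ c₀ * a ∧ |h'| ≤ c₀ * b := by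
  obtain ⟨f', hf, ha, hb⟩ := hf
  exact ⟨c * f', hf.const_mul c, abs_mul_le_of_le hc ha, abs_mul_le_of_le hc hb⟩

/-- Bookkeeping: right multiplication by a constant `c` with `|c| ≤ c₀`. [folklore] -/
theorem bd_mul_const {f : ℝ → ℝ} {S : Set ℝ} {τ a b c₀ : ℝ} (c : ℝ) (hc : |c| ≤ c₀)
    (hf : ∃ f', HasDerivWithinAt f f' S τ ∧ |f τ| ≤ a ∧ |f'| ≤ b) :
    ∃ h', HasDerivWithinAt (fun s => f s * c) h' S τ ∧ |f τ * c| ≤ a * c₀ ∧ |h'| ≤ b * c₀ := by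
  obtain ⟨f', hf, ha, hb⟩ := hf
  exact ⟨f' * c, hf.mul_const c, abs_mul_le_of_le ha hc, abs_mul_le_of_le hb hc⟩

/-- Bookkeeping: post-composition with a one-variable function (chain rule). [folklore] -/
theorem bd_comp {φ f : ℝ → ℝ} {φ' : ℝ} {S : Set ℝ} {τ a b a' b' : ℝ}
    (hf : ∃ f', HasDerivWithinAt f f' S τ ∧ |f τ| ≤ a ∧ |f'| ≤ b)
    (hφ : HasDerivAt φ φ' (f τ)) (ha' : |φ (f τ)| ≤ a') (hb' : |φ'| ≤ b') :
    ∃ h', HasDerivWithinAt (fun s => φ (f s)) h' S τ ∧ |φ (f τ)| ≤ a' ∧ |h'| ≤ b' * b := by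
  obtain ⟨f', hf, -, hb⟩ := hf
  exact ⟨φ' * f', hφ.comp_hasDerivWithinAt τ hf, ha', abs_mul_le_of_le hb' hb⟩

/-! ### Step 4: elementary inequalities and guard bounds of order three -/

/-- Inverting the coefficient `θ κ` (`θ ≥ N⁻¹`, `κ ≥ 1/2`): `|H| ≤ 2N |θ κ H|`. [folklore] -/
theorem abs_le_two_mul_abs_coeff {N θ κ H : ℝ} (hN : 1 ≤ N) (hθ : N⁻¹ ≤ θ) (hκ : 1 / 2 ≤ κ) :
    |H| ≤ 2 * N * |θ * κ * H| := by
  have hN0 : 0 < N := by linarith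
  have hNθ : 1 ≤ N * θ := by
    have h := mul_le_mul_of_nonneg_left hθ hN0.le
    rwa [mul_inv_cancel₀ hN0.ne'] at h
  have hθ0 : 0 < θ := lt_of_lt_of_le (inv_pos.2 hN0) hθ
  have hκ0 : 0 < κ := by linarith
  have e : |θ * κ * H| = θ * κ * |H| := by
    rw [abs_mul, abs_mul, abs_of_pos hθ0, abs_of_pos hκ0]
  rw [e]
  calc |H| ≤ N * θ * |H| := le_mul_of_one_le_left (abs_nonneg H) hNθ
    _ ≤ N * θ * |H| * (2 * κ) := le_mul_of_one_le_right (by positivity) (by linarith)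
    _ = 2 * N * (θ * κ * |H|) := by ring

/-- Inverting `gᵢⱼ = c Qⱼ + θ κ Hᵢⱼ + e` for the log-curvature `Hᵢⱼ` under `θ ≥ N⁻¹`, `κ ≥ 1/2`,
`|c| ≤ 5N³`, `|e| ≤ 2N³`, `|Qⱼ| ≤ q`: `|Hᵢⱼ| ≤ 2N (|gᵢⱼ| + 5N³ q + 2N³)`. [folklore] -/
theorem abs_curv_le {N θ κ H c Q e g q : ℝ} (hN : 1 ≤ N) (hθ : N⁻¹ ≤ θ) (hκ : 1 / 2 ≤ κ)
    (hc : |c| ≤ 5 * N ^ 3) (hQ : |Q| ≤ q) (he : |e| ≤ 2 * N ^ 3)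
    (hg : c * Q + θ * κ * H + e = g) :
    |H| ≤ 2 * N * (|g| + 5 * N ^ 3 * q + 2 * N ^ 3) := by
  have h1 := abs_le_two_mul_abs_coeff (H := H) hN hθ hκ
  have h2 : θ * κ * H = g - c * Q - e := by rw [← hg]; ring
  have h3 : |θ * κ * H| ≤ |g| + 5 * N ^ 3 * q + 2 * N ^ 3 := by
    rw [h2]
    have hcQ : |c * Q| ≤ 5 * N ^ 3 * q := abs_mul_le_of_le hc hQ
    have t1 := abs_sub (g - c * Q) e
    have t2 := abs_sub g (c * Q)
    linarith
  have hN0 : 0 ≤ 2 * N := by linarith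
  exact h1.trans (mul_le_mul_of_nonneg_left h3 hN0)

/-- **The EOS at a point of the band**: bounds on `Zf` and its first three derivatives,
`κ = Zf + η Zf' ≥ 1/2`, `|κ| ≤ 2N`, `|κ'| = |2 Zf' + η Zf''| ≤ 3N`, and the one-variable derivatives
of `Zf`, `Zf'`, `Zf''` at `η ∈ (0, η₁)` (`η₁ ≤ 1`, level `N ≥ K`). [folklore] -/
theorem eos_point {η₀ η₁ K N : ℝ} {Zf : ℝ → ℝ} (hZ : ContDiffOn ℝ ∞ Zf (Ioo (-η₀) η₀))
    (hη₁1 : η₁ ≤ 1) (hη₁₀ : 2 * η₁ ≤ η₀)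
    (hband : ∀ η ∈ Icc 0 η₁, |Zf η| ≤ K ∧ |deriv Zf η| ≤ K ∧ |deriv (deriv Zf) η| ≤ K ∧
      |deriv (deriv (deriv Zf)) η| ≤ K ∧ 1 / 2 ≤ Zf η ∧ 1 / 2 ≤ Zf η + η * deriv Zf η)
    (hKN : K ≤ N) {e : ℝ} (he0 : 0 < e) (he1 : e < η₁) :
    |e| ≤ 1 ∧ |Zf e| ≤ N ∧ |deriv Zf e| ≤ N ∧ |deriv (deriv Zf) e| ≤ N ∧
    |deriv (deriv (deriv Zf)) e| ≤ N ∧ 1 / 2 ≤ Zf e + e * deriv Zf e ∧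
    |Zf e + e * deriv Zf e| ≤ 2 * N ∧ |2 * deriv Zf e + e * deriv (deriv Zf) e| ≤ 3 * N ∧
    HasDerivAt Zf (deriv Zf e) e ∧ HasDerivAt (deriv Zf) (deriv (deriv Zf) e) e ∧
    HasDerivAt (deriv (deriv Zf)) (deriv (deriv (deriv Zf)) e) e := by
  have hmem : e ∈ Icc 0 η₁ := ⟨he0.le, he1.le⟩
  have hmem' : e ∈ Ioo (-η₀) η₀ := ⟨by linarith, by linarith⟩
  obtain ⟨b0, b1, b2, b3, -, l2⟩ := hband e hmem
  have hea : |e| ≤ 1 := by rw [abs_of_pos he0]; linarith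
  have hZa : |Zf e| ≤ N := b0.trans hKN
  have hZ'a : |deriv Zf e| ≤ N := b1.trans hKN
  have hZ''a : |deriv (deriv Zf) e| ≤ N := b2.trans hKN
  have hO : IsOpen (Ioo (-η₀) η₀) := isOpen_Ioo
  have hZ1 : ContDiffOn ℝ ∞ (deriv Zf) (Ioo (-η₀) η₀) := hZ.deriv_of_isOpen hO le_rfl
  have hZ2 : ContDiffOn ℝ ∞ (deriv (deriv Zf)) (Ioo (-η₀) η₀) := hZ1.deriv_of_isOpen hO le_rfl
  refine ⟨hea, hZa, hZ'a, hZ''a, b3.trans hKN, l2, ?_, ?_,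
    ((hZ.differentiableOn (by simp)).differentiableAt (hO.mem_nhds hmem')).hasDerivAt,
    ((hZ1.differentiableOn (by simp)).differentiableAt (hO.mem_nhds hmem')).hasDerivAt,
    ((hZ2.differentiableOn (by simp)).differentiableAt (hO.mem_nhds hmem')).hasDerivAt⟩
  · have h := abs_mul_le_of_le hea hZ'a
    exact (abs_add_le _ _).trans (by linarith)
  · have h := abs_mul_le_of_le hea hZ''a
    have h2 : |2 * deriv Zf e| ≤ 2 * N := by rw [abs_mul, abs_two]; linarith
    exact (abs_add_le _ _).trans (by linarith)

/-- Packing-band monotonicity of the guards. [folklore] -/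
theorem guardAt_mono {η η' M σ : ℝ} {ρ θ : ℝ → T3 → ℝ} {u : ℝ → T3 → V3} {s : ℝ} {x : T3}
    (h : GuardAt η M σ ρ θ u s x) (hη : η ≤ η') : GuardAt η' M σ ρ θ u s x :=
  ⟨h.1.trans_le hη, h.2⟩

/-- The scalar guard bounds of orders two and three not covered by `LogSlope.guard_bounds`:
`ρ ≤ N`, `|∂²ρ|, |∂³θ| ≤ N` and the third derivatives of the velocity components. [folklore] -/
theorem guard_bounds3 {η M N σ : ℝ} {ρ θ : ℝ → T3 → ℝ} {u : ℝ → T3 → V3} {s : ℝ} {x : T3}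
    (hG : GuardAt η M σ ρ θ u s x) (hMN : M ≤ N) (hus : Torus.IsSmooth (u s)) :
    ρ s x ≤ N ∧ (∀ i j, |Torus.partialDeriv i (Torus.partialDeriv j (ρ s)) x| ≤ N) ∧
    (∀ i j k, |Torus.partialDeriv i (Torus.partialDeriv j (Torus.partialDeriv k (θ s))) x| ≤ N) ∧
    (∀ i j k l, |Torus.partialDeriv i (Torus.partialDeriv j
      (Torus.partialDeriv k (fun y => u s y l))) x| ≤ N) := by
  obtain ⟨-, h2, -, -, -, h6⟩ := hG
  have hu1 : Torus.IsContDiff 1 (u s) := hus.isContDiff (by simp)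
  refine ⟨h2.trans hMN, fun i j => (h6 i j 0).2.2.2.1.trans hMN,
    fun i j k => (h6 i j k).2.2.2.2.2.2.2.2.trans hMN, fun i j k l => ?_⟩
  have hfun1 : (Torus.partialDeriv k fun y => u s y l) = fun y => Torus.partialDeriv k (u s) y l :=
    funext fun y => Torus.partialDeriv_apply_coord hu1 k y l
  have hDu : Torus.IsSmooth (Torus.partialDeriv k (u s)) := hus.partialDeriv k
  have hDu1 : Torus.IsContDiff 1 (Torus.partialDeriv k (u s)) := hDu.isContDiff (by simp)
  have hfun2 : (Torus.partialDeriv j fun y => Torus.partialDeriv k (u s) y l) =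
      fun y => Torus.partialDeriv j (Torus.partialDeriv k (u s)) y l :=
    funext fun y => Torus.partialDeriv_apply_coord hDu1 j y l
  have hDDu1 : Torus.IsContDiff 1 (Torus.partialDeriv j (Torus.partialDeriv k (u s))) :=
    (hDu.partialDeriv j).isContDiff (by simp)
  rw [hfun1, hfun2, Torus.partialDeriv_apply_coord hDDu1 i x l]
  have h := PiLp.norm_apply_le
    (Torus.partialDeriv i (Torus.partialDeriv j (Torus.partialDeriv k (u s))) x) l
  rw [Real.norm_eq_abs] at h
  exact h.trans ((h6 i j k).2.2.2.2.2.2.2.1.trans hMN)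

end Summit.AtomisticToContinuum.HydrodynamicLimit.Theorems.ConeLocalisation.Elevator.LogCurvature

namespace Summit.AtomisticToContinuum.HydrodynamicLimit.Theorems.ConeLocalisation.Elevator

open Literature.MathematicalPhysics.KineticTheory

/-- **Registered sub-goal `stub_logCurvature_partA` of the stub `stub_logCurvature`** (part A of its proof,
registered on stmt-AtomisticToContinuum-12504 for the supports lane): the smooth equation of state on a packing
band with three bounded derivatives. [folklore] -/
theorem stub_logCurvature_partA : ∃ η₀ η₁ K : ℝ, ∃ Zf : ℝ → ℝ, 0 < η₁ ∧ η₁ ≤ 1 ∧ 2 * η₁ ≤ η₀ ∧ 1 ≤ K ∧ ContDiffOn ℝ (⊤ : ℕ∞) Zf (Set.Ioo (-η₀) η₀) ∧ Set.EqOn hsCompressibility Zf (Set.Ioo 0 η₀) ∧ ∀ η ∈ Set.Icc 0 η₁, |Zf η| ≤ K ∧ |deriv Zf η| ≤ K ∧ |deriv (deriv Zf) η| ≤ K ∧ |deriv (deriv (deriv Zf)) η| ≤ K ∧ 1 / 2 ≤ Zf η ∧ 1 / 2 ≤ Zf η + η * deriv Zf η :=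
  LogCurvature.eos_band3

end Summit.AtomisticToContinuum.HydrodynamicLimit.Theorems.ConeLocalisation.Elevator

end
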